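import Summits.BirchSwinnertonDyer.Rank1Residual.Supersingular.KobayashiMainConjectureKuriharaRigidity
import Literature.NumberTheory.EllipticCurves.PAdicHeights
import HarnessLib

/-!
# Kolyvagin-system rigidity AT THE PRIME `3`, read through Kobayashi 2003 Thm 7.4, in the ± currency:
# Kim–Kim–Sun, Selecta Math. 26 (2020) Thm 1.1 («`p > 2`») — a unit Kurihara number ⟹ Kato's main conjecture —
# composed with Kobayashi's Thm 7.4 (`p` odd, `a_p = 0`): the `p = 3` ENGINE of line `kurihara_rigidity` of crux
# `KobayashiLowerHalfLargeImage` (route `SignedLowerHalves`, item stmt-BirchSwinnertonDyer-19001), typed as ONE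
# composite binder with its printed side condition (Tam) (cell `bsd-ssimc`, seat `bsd-line-slh-p1`, lead gen 2)

HONEST FRAMING: nothing is asserted about any curve; nothing is booked; BSD is not proved by any of this. This
file is the `p = 3` companion of `KobayashiMainConjectureKuriharaRigidity.lean` (same directory; binders
`Kim2026_thm111_via_kobayashi74` [Kim AJM 2026 Thm 1.11, «`p ≥ 5`»] and `CastellaSano2026_thm1_via_kobayashi74_OPEN`
[«`p > 3`»]) and follows its pattern exactly: ONE `def … : Prop` per printed implication whose conclusion is
Kato's main conjecture for `E` over `ℚ_∞`, READ THROUGH Kobayashi's Thm 7.4 in the tree's ± currency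
`KobayashiMainConjecture W p ε`, because the tree has no predicate «Kato's main conjecture for `E` at `p`». No
`_holds` (size XL). The line's card had typed its residue `stub_three` as «no engine at 3: the rigidity engines
are printed for `p > 3`»; that is true of Kim 2026 and Castella–Sano 2026 but NOT of Kim–Kim–Sun 2020, read here.

## The printed statements

* C.-H. Kim, M. Kim, H.-S. Sun, *On the indivisibility of derived Kato's Euler systems and the main conjecture
  for modular forms*, Selecta Math. (N.S.) 26 (2020), Paper No. 31 = arXiv:1709.05780 (held text
  `paper:arxiv-1709.05780`, page files `pNNNN.txt`). Standing (§1.2.1, p0003 L39–L41): "Let `p > 2` be a prime.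
  Let `f = ∑ a_n(f)qⁿ ∈ S₂(Γ₁(N), ψ)` be a newform with character `ψ` and assume `(N,p) = 1`." (again §2, p0008
  L5: "Let `p` be a prime `> 2`"). Kolyvagin primes and Kurihara numbers (p0004 L1–L9): `n` a square-free product
  of Kolyvagin primes, `[a/n]⁺_f` the `(+)`-part of the modular symbol normalised by "the `(+)`-part of an
  integral canonical period of `f`" (§5.4), `δ̃_n := ∑_{a ∈ (ℤ/n)ˣ} \overline{[a/n]⁺_f}·∏_{ℓ∣n}\overline{log_{𝔽_ℓ}(a)}
  ∈ 𝔽_λ`. **Theorem 1.1 (Main Theorem)** (p0004 L11–L31), VERBATIM up to the held text's lost symbols: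
  "Assume the following conditions: (NA) `a_p(f) ≢ 1 (mod λ)` and `a_p(f) ≢ ψ(p) (mod λ)`; (Im) the image of `ρ̄`
  contains a conjugate of `SL₂(𝔽_p)`; (Tam) for a prime `q`, • [first clause], • `ord_q(N(ρ̄)) = ord_q(N)`
  otherwise. If `δ̃_n ≠ 0 ∈ 𝔽_λ` for some `n`, then • the derived Kato's Euler system does not vanish modulo `λ`,
  and • the Iwasawa main conjecture à la Kato (Conjecture 3.3) holds for `(f, ℚ_∞/ℚ)`." with (p0004 L40–L43):
  "Condition (Tam) is a necessary but very mild condition. The first condition of Condition (Tam) corresponds to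
  the following divisibility criterion `p ∤ (∏_{q∣N_sp}(q−1))·(∏_{q∣N_ns}(q+1))` where `N_sp := ∏_{q∥N, a_q(f)=1} q`
  and `N_ns := ∏_{q∥N, a_q(f)=−1} q`. Indeed, if we have `δ̃_n ≠ 0` for some `n`, then the second condition of
  Condition (Tam) is automatic (Remark 2.3)."; Conjecture 3.3 (p0011): "`char_Λ(ℍ¹(T_f(1))/Λ𝐳_Kato) =
  char_Λ(ℍ²(T_f(1)))`" (Kato's; `ℍ¹(T_f(1)) ≅ H¹(ℚ_∞, T_f(1))`); §8.2.2 (p0022), the authors' own `p = 3` GOOD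
  SUPERSINGULAR example: "`E`: `y² = x³ − 67x + 926` with conductor `760 = 2³·5·19` … the residual
  representation is surjective, `a₃(E) = 3`, `a₅(E) = 1`, `a₁₉(E) = −1`, and `L(E,1)/Ω⁺_E = 2`. Since
  `3 ∤ (5−1)·(19+1) = 80` and `δ̃₁ ∈ 𝔽₃ˣ`, Kato's main conjecture for `E` with `p = 3` holds." — which fixes the
  reading of (Tam)'s first clause on an elliptic curve: over the primes `q ∥ N` (multiplicative), `p ∤ q − 1` at
  the split ones (`a_q = 1`) and `p ∤ q + 1` at the non-split ones (`a_q = −1`); additive primes impose nothing.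
* S. Kobayashi, Invent. Math. 152 (2003) 1–36, standing hypotheses `E/ℚ`, `p` an ODD prime of good supersingular
  reduction with `a_p = 0` (so `p = 3` with `a₃ = 0` is included); **Theorem 7.4** (p. 13): "The three
  conjectures, namely, Kato's main conjecture (Sect. 5), the even main conjecture and the odd main conjecture
  (Sect. 4) are equivalent." (component `η = 1`: reading `KR-74-trivial-component` of the sibling file); the tree's
  package fact `Kobayashi2003.thm62_63_73_signedColemanKato_zeta` carries `p ≠ 2` only.

## Readings (weaker than print, never stronger; flags for the referee)

`KKS20@3-MR-H4` (the tree's EXISTING flag, `Rank1Residual/Supersingular/SharpFlatKuriharaRoute.lean`,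
`X8KimLargeImageOPEN.lean`; DISPLAYED, not resolved here): KKS Lemma 4.3 takes Mazur–Rubin's (H.1)–(H.4) from
(Im), and (H.4) («`Hom_{𝔽_λ[G_ℚ]}(T̄, T̄^*(1)) = 0` or `p > 4`») fails for the self-dual `E[3]`; Mazur–Rubin use
`p > 4` only to choose useful primes, and at `p = 3` that step is Sakamoto's (Doc. Math. 27 (2022) App. A, in
his rank-`0` setting; J. Théor. Nombres Bordeaux 36 (2024) 919–946, Kolyvagin systems at `p = 3`). The binder
records the theorem AS PRINTED («`p > 2`»); a referee ruling on the flag decides whether consumers may book it.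
`KKS20-tower` (extra hypothesis, weaker than print): Kato's integrality (12.5.2) wants the image of `G_ℚ → Aut T₃E`
to contain `SL₂(ℤ₃)`, which mod-`3` surjectivity alone does not give in general (Serre/Elkies); the binder
therefore ALSO carries the full tower `ρ̄_{E,3ⁿ}` onto for all `n` — a THEOREM at a good supersingular `3` from
`Surj` (`GoodSS.towerSurj_of_surj`, Wuthrich 2014 Lemma 20), discharged by the Theorems-side consumers.
`KKS20-Tam`: (Tam)'s first clause is carried as the predicate `KimKimSun2020TamAt W p` below (the displayed
divisibility criterion, split/non-split read as `HasSplitMultiplicativeReductionAtPrime` / its negation at a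
multiplicative prime, `a_q = ±1` ⟺ split/non-split: Silverman AEC VII.5, ATAEC IV.9); its second clause
(`ord_q N(ρ̄) = ord_q N`) is NOT displayed because the source states it automatic under the certificate (p0004
L43, Remark 2.3: otherwise the Tamagawa defect kills every Kurihara number). `KKS20-can-period` (twin of
`KR-period`): KKS normalise `[a/n]⁺` by Vatsal's integral canonical period `Ω^{can,+}_f` (§5.4, mod-`p`
multiplicity one under (Im), `(N,p) = 1`); for the newform of an elliptic curve with (Im) and the period transfer
`Ω(W) = u·Ω⁺_f`, `|u|_p = 1` these normalisations are `p`-adic units apart (the source's own §8.2.2 reads `δ̃₁`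
off `L(E,1)/Ω⁺_E`; Kim 2026 §1.3.5/§1.4 normalises the same `δ̃_n` by `Ω⁺_E`), so `kuriharaNumber f p n ψ ≠ 0`
⟺ `δ̃_n ≠ 0`; reading, not formalised. `KR-cyclic-levels`, `KR-74-trivial-component`, `KR-IMC-forms` (KKS Conj.
3.3 = Kobayashi §5 = Kato Conj. 12.10 for `T_pE` over `ℚ_∞`, Prop. 3.4: independent of the finite-index choice
of zeta element): as in the sibling file, verbatim. (NA) is automatic at `a_p = 0`, `ψ = 1` and is therefore
discharged, not displayed (`a_p = 0` IS displayed). Everything recorded is implied by, never stronger than, the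
print under these readings; nothing asserted.

## Contents

§1 the side condition `KimKimSun2020TamAt` and the binder `KimKimSun2020_thm11_via_kobayashi74_three`; §2 the
pair-level consumer `kobayashiMainConjecture_three_of_kuriharaUnitAt` (tower and period as inputs; the X7
consumers discharging both live Theorems-side, `…KuriharaRigidityThreeEngine.lean`).

References: [KimKimSun2020] Thm 1.1, (Tam) p. 4, Rem 2.3, Conj 3.3, Prop 3.4, Lemma 4.3, §5.4, §8.2.2;
[Kobayashi2003] Thm 7.4 (p. 13), Thm 1.2; [Kato2004Asterisque] (12.5.2), Conj 12.10; [MazurRubin2004] §3.5 (H.4),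
Thm 5.3.10; [Sakamoto2022pSelmer] App. A; [Sakamoto2024KolyvaginThree] Thm 1.1; [Wuthrich2014] Lemma 20;
[GreenbergVatsal2000] Rem 3.4; [Mazur1978] Cor 4.1 (the `p = 3` period fact `realPeriodRat_eq_unit_mul_plusPeriod_three`).
-/

set_option autoImplicit false

noncomputable section

open scoped Classical MatrixGroups ModularForm

open CongruenceSubgroup WeierstrassCurve Literature.NumberTheory.EllipticCurves
  Literature.NumberTheory.EllipticCurves.ModularForms
  Literature.NumberTheory.EllipticCurves.Rank1Residual
  Literature.NumberTheory.EllipticCurves.Rank1Residual.Typed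
  Summit.BirchSwinnertonDyer.Rank1Residual.X4

namespace Summit.BirchSwinnertonDyer.Rank1Residual.Supersingular

/-! ### §1 The side condition (Tam) and the binder -/

/-- **Kim–Kim–Sun's condition (Tam), first clause, for the newform of `W` at the prime `p`** — "the divisibility
criterion `p ∤ (∏_{q∣N_sp}(q−1))·(∏_{q∣N_ns}(q+1))`, `N_sp := ∏_{q∥N, a_q(f)=1} q`, `N_ns := ∏_{q∥N, a_q(f)=−1} q`"
(Selecta Math. 26 (2020) p. 4; checked as «`3 ∤ (5−1)·(19+1)`» in their §8.2.2): at every prime `q` of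
MULTIPLICATIVE reduction of `W`, `p ∤ q − 1` if the reduction is split (`a_q = 1`) and `p ∤ q + 1` if it is
non-split (`a_q = −1`). Additive primes impose nothing; the second clause of (Tam) is automatic under a unit
Kurihara number (loc. cit. p. 4, Remark 2.3) and is not part of this predicate (reading `KKS20-Tam`). A predicate;
nothing asserted. [cite: KimKimSun2020, Thm. 1.1 condition (Tam) and the divisibility criterion (p. 4), §8.2.2]
[cite: SilvermanAEC2009, VII.5 (split/non-split multiplicative reduction)] -/
def KimKimSun2020TamAt (W : WeierstrassCurve ℚ) (p : ℕ) : Prop :=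
  ∀ (q : ℕ) [Fact q.Prime], W.HasMultiplicativeReductionAtPrime q →
    (W.HasSplitMultiplicativeReductionAtPrime q → ¬ p ∣ q - 1) ∧
    (¬ W.HasSplitMultiplicativeReductionAtPrime q → ¬ p ∣ q + 1)

/-- **NAMED FACT (two PUBLISHED theorems composed; flag `KKS20@3-MR-H4` displayed) — Kim–Kim–Sun, Selecta
Math. 26 (2020) Thm 1.1 AT `p = 3`, READ THROUGH Kobayashi, Invent. Math. 152 (2003) Thm 7.4, in the ±
currency.** KKS Thm 1.1 («`p > 2`», any good `p`): for a newform `f ∈ S₂(Γ₁(N), ψ)`, `(N,p) = 1`, under (NA),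
(Im) and (Tam), a Kurihara number `δ̃_n ≢ 0` at some square-free product of Kolyvagin primes implies Kato's main
conjecture `char_Λ(ℍ¹/Λ𝐳_Kato) = char_Λ(ℍ²)` for `(f, ℚ_∞/ℚ)`; their §8.2.2 runs it at `p = 3` for a good
supersingular elliptic curve. Kobayashi Thm 7.4 (`p` odd good supersingular, `a_p = 0`, component `η = 1`):
Kato's main conjecture ⟺ the even ⟺ the odd main conjecture. TRANSCRIBED on the tree's objects, for the newform
of an elliptic curve: `W` globally minimal, `p = 3` of good reduction with `a₃ = 0` ((NA) automatic, `ψ = 1`),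
`ρ̄_{W,3}` onto (⟹ (Im)) AND the whole tower `ρ̄_{W,3ⁿ}` onto (reading `KKS20-tower`, weaker than print), (Tam)'s
first clause `KimKimSun2020TamAt W 3` (its second clause automatic under the certificate, p. 4), a newform `f` of
`W` with the period transfer `Ω(W) = u·Ω⁺_f`, `|u|₃ = 1` (readings `KR-period` / `KKS20-can-period`), and the
certificate `X4.KuriharaUnitAt W 3 f` — a CYCLIC Kolyvagin level `n ∈ 𝒩₁(W,3)` with surjective discrete
logarithms and `kuriharaNumber f 3 n ψ ≠ 0` (reading `KR-cyclic-levels`) ⟹ `KobayashiMainConjecture W 3 ε` for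
EVERY sign `ε`. Weaker than print, never stronger; nothing asserted; no `_holds` (size XL). FLAG `KKS20@3-MR-H4`
(module docstring): the printed proof's appeal to Mazur–Rubin at `p = 3` needs Sakamoto's `p = 3` choice of
useful primes; consumers display this binder as a hypothesis until a referee rules on the flag.
[cite: KimKimSun2020, Thm. 1.1 (p. 4), divisibility criterion and «second condition automatic» (p. 4), Remark 2.3, Conjecture 3.3 and Prop. 3.4, Lemma 4.3, §5.4, §8.2.2]
[cite: Kobayashi2003, Thm. 7.4 (p. 13), Thm. 7.3 ii), Thm. 1.2, Conjecture (p. 2) and §4–§5]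
[cite: MazurRubin2004, §3.5 hypothesis (H.4) and Thm. 5.3.10] [cite: Sakamoto2022pSelmer, App. A (p = 3)]
[cite: Mazur1978, Cor. 4.1] [cite: GreenbergVatsal2000, §3, Remark 3.4] -/
def KimKimSun2020_thm11_via_kobayashi74_three : Prop :=
  ∀ (W : WeierstrassCurve ℚ) [W.IsElliptic] [W.IsGloballyMinimal] (p : ℕ) [Fact p.Prime],
    p = 3 → W.HasGoodReductionAtPrime p → W.frobeniusTrace p = 0 →
    W.HasSurjectiveModNGaloisRep p → (∀ n : ℕ, W.HasSurjectiveModNGaloisRep (p ^ n : ℕ)) →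
    KimKimSun2020TamAt W p →
    ∀ {N : ℕ} [NeZero N] (f : CuspForm (Gamma0 N) 2), IsNewformOf W f →
    (∃ u : ℚ, ‖(u : ℚ_[p])‖ = 1 ∧ W.realPeriodRat = u * plusPeriod f) →
    KuriharaUnitAt W p f →
    ∀ ε : ℤˣ, KobayashiMainConjecture W p ε

/-! ### §2 Pair-level consumer (tower and period displayed) -/

section Consumers

variable (W : WeierstrassCurve ℚ) [W.IsElliptic] [W.IsGloballyMinimal] (p : ℕ) [hp : Fact p.Prime]

/-- **A unit Kurihara number at one cyclic level gives Kobayashi's main conjecture for both signs at `p = 3`**,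
GRANTED the binder `KimKimSun2020_thm11_via_kobayashi74_three` (`hKKS`, flag `KKS20@3-MR-H4`) and the `p = 3`
period fact `realPeriodRat_eq_unit_mul_plusPeriod_three` (`h3`: Greenberg–Vatsal Rem 3.4 with Mazur 1978 Cor 4.1 at
a GOOD `3` with `E[3]` irreducible — here from `ρ̄` onto): good `3`, `a₃ = 0`, `ρ̄_{W,3}` onto, the `3`-adic tower
onto (displayed: `htower`; a theorem on the supersingular classes, `GoodSS.towerSurj_of_surj`), (Tam) at `3`, a
newform `f` of `W` (any level) with `X4.KuriharaUnitAt W 3 f`. CONDITIONAL; closes nothing.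
[cite: KimKimSun2020, Thm. 1.1 and §8.2.2] [cite: Kobayashi2003, Thm. 7.4 (p. 13)] [cite: GreenbergVatsal2000, §3, Remark 3.4] -/
theorem kobayashiMainConjecture_three_of_kuriharaUnitAt (hKKS : KimKimSun2020_thm11_via_kobayashi74_three)
    (h3 : realPeriodRat_eq_unit_mul_plusPeriod_three) (hp3 : p = 3) (hgood : W.HasGoodReductionAtPrime p)
    (hap : W.frobeniusTrace p = 0) (hs : Surj W p) (htower : ∀ n : ℕ, W.HasSurjectiveModNGaloisRep (p ^ n : ℕ))
    (htam : KimKimSun2020TamAt W p) {N : ℕ} [NeZero N] (f : CuspForm (Gamma0 N) 2) (hf : IsNewformOf W f)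
    (hunit : KuriharaUnitAt W p f) (ε : ℤˣ) : KobayashiMainConjecture W p ε := by
  subst hp3
  exact hKKS W 3 rfl hgood hap hs htower htam f hf
    (h3 W hgood (hasIrreducibleModPGaloisRep_of_hasSurjectiveModNGaloisRep W 3 hs) f hf) hunit ε

omit [W.IsElliptic] [W.IsGloballyMinimal] hp in
/-- **(Tam) at `p` is vacuous for a curve with NO multiplicative prime** (every bad prime additive — e.g. the
squarefull conductors of Kim–Kim–Sun's §8.1): then `KimKimSun2020TamAt W p` holds for every `p`. [cite: KimKimSun2020, §8.1 and (Tam) p. 4] -/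
theorem kimKimSun2020TamAt_of_forall_not_multiplicative
    (h : ∀ (q : ℕ) [Fact q.Prime], ¬ W.HasMultiplicativeReductionAtPrime q) : KimKimSun2020TamAt W p :=
  fun q _ hq => absurd hq (h q)

end Consumers

end Summit.BirchSwinnertonDyer.Rank1Residual.Supersingular
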